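import Literature.NumberTheory.Rogawski1990.ArchInnerTransferSideCompact   -- ★ `charpoly_archPiEquivCM_eq_of_corresponds`; brings ★ `ArchimedeanTransfer` (`IsArchNormPair`, `ArchTransferFactor`, `endoEmbArch`), ★ `archPiEquivCM`
import Literature.NumberTheory.Rogawski1990.EndoscopicClassTransfer         -- ★ `charpoly_endoGL`
import Literature.LinearAlgebra.Matrix.Diagonalization                      -- ★ `exists_mulVec_eq_smul_of_isRoot_charpoly` (an eigenvalue has an eigenvector)
import HarnessLib

/-!
# At a DEFINITE place a split `γ_H` has no endoscopic partner: the `Δ`-side vanishes identically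
# («(W1-cont-split)» L1 (VANISH-def); Rogawski 1990 §4.3, §14.3; Shelstad 1979 §4)

Topic `NumberTheory/Rogawski1990`; namespace `Literature.NumberTheory.Rogawski1990`.  THEOREMS ONLY (no `def`, no instance, no notation, no axiom, no named fact, no
`sorry`).  Cell `pub/hodgecm-mathlib`, crux H413 (`stmt-HodgeConjecture-24833`), F0∕P3c line LH3 (closer stub `stub_N9`, DIRECT ROAD memo `MEMO-N9-direct-road.v1∕v2-delta`);
seat LH3-p03 (g2), lemma 1 of organ «(W1-cont-split)» (LH3-plan (g2) DEALER WORDS #3 (g2) 2026-09-02T05:13:20Z: «at definite `w ∈ S` there is no partner and the Δ″-side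
= 0 — state that vanishing as lemma 1»).  Count-neutral kit for (M1) of L2 «Transf is well-defined».

THE MATHEMATICS.  (§1) If `J ∈ M_N(ℂ)` is positive (or negative) DEFINITE hermitian and `g ∈ U(J)(ℂ)` (`gᴴ J g = J`, ★ `unitaryGroupOfForm (starRingEnd ℂ) J`), every root `z`
of the characteristic polynomial of `g` has `|z| = 1`: for an eigenvector `v` (★ `exists_mulVec_eq_smul_of_isRoot_charpoly`), `vᴴ J v = (gv)ᴴ J (gv) = |z|² vᴴ J v`
with `vᴴ J v ≠ 0`.  (§2) In the frame of `stub_N9` — `H_∞ = U(Φ₂)(L⁺ ⊗ ℝ) × U(Φ₁)(L⁺ ⊗ ℝ)`, inner form `G′_∞ = U(H′)(L⁺ ⊗ ℝ)` — let `w` be a complex place at which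
`σ_w(H′)` is definite (`G′_w ≅ U(3)` compact).  If the `2`-block `(γ_H)_{2,w}` of `γ_H ∈ H_∞` has a characteristic root of absolute value `≠ 1` (e.g. `γ_H` lies in a
Cartan `T_S` SPLIT at `w ∈ S`: eigenvalues `e^{±x + iθ}`, `x ≠ 0`), then NO `γ′ ∈ G′_∞` is a norm partner of `γ_H` (★ `IsArchNormPair`): a partner is `GL₃(L ⊗ ℝ)`-conjugate
to `ι_∞(γ_H)` (★ `Corresponds`), so at `w` its characteristic polynomial is `charpoly (γ_H)_{2,w} · charpoly (γ_H)_{1,w}` (★ `charpoly_archPiEquivCM_eq_of_corresponds`, ★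
`charpoly_endoGL`), which has the non-unimodular root — contradicting §1 for `γ′_w ∈ U(σ_w H′)(ℂ)`.  Hence every archimedean transfer factor (★ `ArchTransferFactor`,
supported on norm pairs) vanishes at `(γ_H, ·)` and the `Δ`-side `Σ_{[γ′]} Δ(γ_H, γ′) Φ([γ′])` is `0` for EVERY class function `Φ` — the Δ″-side of `stub_N9` restricted
to a Cartan split at a definite place is identically zero (print: «`Φ^st(γ, f_v) = 0` if `γ` does not occur in `G′`», (14.2.1); the `H`-analogue for the transfer (4.3.1)).

* §1 `norm_eq_one_of_isRoot_charpoly_of_mem_unitaryGroupOfForm_of_posDef` (+ `…_of_neg_posDef`) — definite unitary groups have unimodular spectrum (any `N`).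
* §2 `charpoly_archPiEquivCM_of_isArchNormPair` — at every place the partner's characteristic polynomial is `charpoly (γ_H)_{2,w} · charpoly (γ_H)_{1,w}`;
  **`not_isArchNormPair_of_posDef_place`** — no partner at a definite place for a `γ_H` with a non-unimodular root at `w`;
  **`finsum_delta_mul_eq_zero_of_posDef_place`** — the `Δ`-side vanishes identically for every ★ `ArchTransferFactor L H′` and every `Φ`.
HONEST LABEL: HC_CM is proved only modulo the 7 printed citations (2 remaining: hLiu418 = `stmt-HodgeConjecture-24832`, h413 = `stmt-HodgeConjecture-24833`) until rung 0
closes; count-neutral kit (it pays no organ; books unchanged).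

## References
* [Rogawski1990] J. D. Rogawski, *Automorphic Representations of Unitary Groups in Three Variables*, Ann. of Math. Stud. 123 (1990), §3.1 p. 19 (stable conjugacy = `GL₃`
  conjugacy), §4.3 pp. 42–43 (norm pairs, (4.3.1)), §14.2 (14.2.1) p. 232, §14.3 p. 234 (`Δ′_∞` supported on matching pairs).
* [Shelstad1979] D. Shelstad, *Characters and inner forms of a quasi-split group over ℝ*, Compositio Math. 39 (1979), §4 (Cartan subgroups not occurring in an inner form).
* [HornJohnson2013] R. A. Horn, C. R. Johnson, *Matrix Analysis*, 2nd ed. (2013), Thm. 2.5.6 ∕ §7.1 (unitary similarity for a definite form; unimodular spectrum).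
-/

set_option autoImplicit false

noncomputable section

open NumberField NumberField.InfinitePlace NumberField.mixedEmbedding Matrix Polynomial
open Literature.NumberTheory.Automorphic Literature.NumberTheory.Automorphic.UnitaryGroup
open scoped MatrixGroups Matrix ComplexConjugate ComplexOrder

namespace Literature.NumberTheory.Rogawski1990

/-! ## §1 Definite unitary groups have unimodular spectrum -/

section Definite

variable {N : ℕ}

/-- `(M.map conj)ᵀ = Mᴴ` over `ℂ`. [folklore] [cite: HornJohnson2013, §0.2] -/
private theorem transpose_map_starRingEnd' (M : Matrix (Fin N) (Fin N) ℂ) : (M.map (starRingEnd ℂ))ᵀ = Mᴴ := by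
  ext i j
  simp [Matrix.conjTranspose_apply]

/-- **A `J`-unitary matrix for a POSITIVE DEFINITE hermitian `J` has unimodular spectrum**: `g ∈ U(J)(ℂ)`, `charpoly g (z) = 0 ⇒ |z| = 1` (eigenvector `v`:
`vᴴ J v = (g v)ᴴ J (g v) = |z|² · vᴴ J v`, and `vᴴ J v > 0`). [cite: HornJohnson2013, Thm. 2.5.6] [cite: Rogawski1990, §3.1 p. 19] -/
theorem norm_eq_one_of_isRoot_charpoly_of_mem_unitaryGroupOfForm_of_posDef {J : Matrix (Fin N) (Fin N) ℂ} (hJ : J.PosDef)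
    {g : GL (Fin N) ℂ} (hg : g ∈ unitaryGroupOfForm (starRingEnd ℂ) J) {z : ℂ} (hz : ((g : Matrix (Fin N) (Fin N) ℂ)).charpoly.IsRoot z) :
    ‖z‖ = 1 := by
  obtain ⟨v, hv0, hv⟩ := Literature.LinearAlgebra.Matrix.exists_mulVec_eq_smul_of_isRoot_charpoly (g : Matrix (Fin N) (Fin N) ℂ) hz
  have hmem : ((g : Matrix (Fin N) (Fin N) ℂ))ᴴ * J * (g : Matrix (Fin N) (Fin N) ℂ) = J := by
    rw [← transpose_map_starRingEnd']; exact mem_unitaryGroupOfForm_iff.1 hg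
  -- `(gv)ᴴ J (gv) = vᴴ J v`
  have h1 : star ((g : Matrix (Fin N) (Fin N) ℂ) *ᵥ v) ⬝ᵥ (J *ᵥ ((g : Matrix (Fin N) (Fin N) ℂ) *ᵥ v)) = star v ⬝ᵥ (J *ᵥ v) := by
    rw [Matrix.star_mulVec, Matrix.mulVec_mulVec, Matrix.dotProduct_mulVec, Matrix.vecMul_vecMul, ← Matrix.mul_assoc, hmem,
      ← Matrix.dotProduct_mulVec]
  -- `(gv)ᴴ J (gv) = z̄ z · vᴴ J v`
  have h2 : star ((g : Matrix (Fin N) (Fin N) ℂ) *ᵥ v) ⬝ᵥ (J *ᵥ ((g : Matrix (Fin N) (Fin N) ℂ) *ᵥ v)) = star z * z * (star v ⬝ᵥ (J *ᵥ v)) := by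
    rw [hv, star_smul, Matrix.mulVec_smul, smul_dotProduct, dotProduct_smul, smul_eq_mul, smul_eq_mul, mul_assoc]
  -- `vᴴ J v ≠ 0`
  have hq : star v ⬝ᵥ (J *ᵥ v) ≠ 0 := by
    intro h0
    have hpos := hJ.re_dotProduct_pos hv0
    rw [h0] at hpos
    simp at hpos
  have hzz : star z * z = 1 := by
    have h3 : (star z * z - 1) * (star v ⬝ᵥ (J *ᵥ v)) = 0 := by rw [sub_mul, one_mul, ← h2, h1, sub_self]
    rcases mul_eq_zero.1 h3 with h | h
    · exact sub_eq_zero.1 h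
    · exact absurd h hq
  have hnsq : Complex.normSq z = 1 := by
    have h := Complex.normSq_eq_conj_mul_self (z := z)
    rw [show (starRingEnd ℂ) z = star z from rfl, hzz] at h
    exact_mod_cast h
  have hsq : ‖z‖ ^ 2 = 1 := by rw [← Complex.normSq_eq_norm_sq]; exact hnsq
  rw [← Real.sqrt_sq (norm_nonneg z), hsq, Real.sqrt_one]

/-- `U(J) = U(−J)`: the defining equation is linear in the form. [cite: Rogawski1990, §1.9 p. 8] -/
theorem mem_unitaryGroupOfForm_neg_iff {J : Matrix (Fin N) (Fin N) ℂ} {g : GL (Fin N) ℂ} :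
    g ∈ unitaryGroupOfForm (starRingEnd ℂ) (-J) ↔ g ∈ unitaryGroupOfForm (starRingEnd ℂ) J := by
  rw [mem_unitaryGroupOfForm_iff, mem_unitaryGroupOfForm_iff, Matrix.mul_neg, Matrix.neg_mul, neg_inj]

/-- **The same for a NEGATIVE DEFINITE form** (`U(J) = U(−J)`). [cite: HornJohnson2013, Thm. 2.5.6] [cite: Rogawski1990, §3.1 p. 19] -/
theorem norm_eq_one_of_isRoot_charpoly_of_mem_unitaryGroupOfForm_of_neg_posDef {J : Matrix (Fin N) (Fin N) ℂ} (hJ : (-J).PosDef)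
    {g : GL (Fin N) ℂ} (hg : g ∈ unitaryGroupOfForm (starRingEnd ℂ) J) {z : ℂ} (hz : ((g : Matrix (Fin N) (Fin N) ℂ)).charpoly.IsRoot z) :
    ‖z‖ = 1 :=
  norm_eq_one_of_isRoot_charpoly_of_mem_unitaryGroupOfForm_of_posDef hJ (mem_unitaryGroupOfForm_neg_iff.2 hg) hz

end Definite

/-! ## §2 No endoscopic partner at a definite place for a `γ_H` with a non-unimodular root there; the `Δ`-side vanishes -/

section NoPartner

variable (L : Type) [Field L] [NumberField L] [IsCMField L] (H' : Matrix (Fin 3) (Fin 3) L)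

/-- **The partner's characteristic polynomial, place by place**: if `γ_H ↔ γ′` (★ `IsArchNormPair`: `ι_∞(γ_H)` and `γ′` conjugate in `GL₃(L ⊗ ℝ)`) then at every complex
place `w`, `charpoly γ′_w = charpoly (γ_H)_{2,w} · charpoly (γ_H)_{1,w}` (★ `charpoly_archPiEquivCM_eq_of_corresponds` + ★ `charpoly_endoGL` mapped by `evalC L w`).
[cite: Rogawski1990, §4.3 p. 42; §3.1 p. 19] -/
theorem charpoly_archPiEquivCM_of_isArchNormPair
    (γH : ↥(UnitaryGroup.arch (↥(maximalRealSubfield L)) L (IsCMField.complexConj L) 2 (Matrix.of fun i j : Fin 2 => if i.val + j.val + 1 = 2 then (1 : L) else 0)) ×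
      ↥(UnitaryGroup.arch (↥(maximalRealSubfield L)) L (IsCMField.complexConj L) 1 (Matrix.of fun i j : Fin 1 => if i.val + j.val + 1 = 1 then (1 : L) else 0)))
    (γ' : ↥(UnitaryGroup.arch (↥(maximalRealSubfield L)) L (IsCMField.complexConj L) 3 H')) (h : IsArchNormPair L H' γH γ')
    (w : {w : InfinitePlace L // w.IsComplex}) :
    (((archPiEquivCM 3 L H' γ' w : ↥(archLocal L 3 H' w)) : GL (Fin 3) ℂ) : Matrix (Fin 3) (Fin 3) ℂ).charpoly =
      (((archPiEquivCM 2 L (Matrix.of fun i j : Fin 2 => if i.val + j.val + 1 = 2 then (1 : L) else 0) γH.1 w :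
          ↥(archLocal L 2 (Matrix.of fun i j : Fin 2 => if i.val + j.val + 1 = 2 then (1 : L) else 0) w)) : GL (Fin 2) ℂ) : Matrix (Fin 2) (Fin 2) ℂ).charpoly *
        (((archPiEquivCM 1 L (Matrix.of fun i j : Fin 1 => if i.val + j.val + 1 = 1 then (1 : L) else 0) γH.2 w :
          ↥(archLocal L 1 (Matrix.of fun i j : Fin 1 => if i.val + j.val + 1 = 1 then (1 : L) else 0) w)) : GL (Fin 1) ℂ) : Matrix (Fin 1) (Fin 1) ℂ).charpoly := by
  rw [← charpoly_archPiEquivCM_eq_of_corresponds L ((isArchNormPair_iff L H' γH γ').1 h) w]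
  rw [coe_archPiEquivCM_apply, coe_archPiEquivCM_apply, coe_archPiEquivCM_apply]
  have h3 : ((Matrix.GeneralLinearGroup.map (evalC L w) ((endoEmbArch L γH).val : GL (Fin 3) (mixedSpace L)) : GL (Fin 3) ℂ) : Matrix (Fin 3) (Fin 3) ℂ) =
      ((((endoEmbArch L γH).val : GL (Fin 3) (mixedSpace L))) : Matrix (Fin 3) (Fin 3) (mixedSpace L)).map (evalC L w) := rfl
  have h2 : ((Matrix.GeneralLinearGroup.map (evalC L w) (γH.1.val : GL (Fin 2) (mixedSpace L)) : GL (Fin 2) ℂ) : Matrix (Fin 2) (Fin 2) ℂ) =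
      (((γH.1.val : GL (Fin 2) (mixedSpace L))) : Matrix (Fin 2) (Fin 2) (mixedSpace L)).map (evalC L w) := rfl
  have h1 : ((Matrix.GeneralLinearGroup.map (evalC L w) (γH.2.val : GL (Fin 1) (mixedSpace L)) : GL (Fin 1) ℂ) : Matrix (Fin 1) (Fin 1) ℂ) =
      (((γH.2.val : GL (Fin 1) (mixedSpace L))) : Matrix (Fin 1) (Fin 1) (mixedSpace L)).map (evalC L w) := rfl
  rw [h3, h2, h1, Matrix.charpoly_map, Matrix.charpoly_map, Matrix.charpoly_map, coe_endoEmbArch, charpoly_endoGL, Polynomial.map_mul]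

/-- **NO PARTNER AT A DEFINITE PLACE.**  Let `w` be a complex place at which `σ_w(H′)` is positive or negative definite (`G′_w` compact).  If the `2`-block of `γ_H`
at `w` has a characteristic root `z` with `|z| ≠ 1` — e.g. `γ_H` in a Cartan of `H_∞` SPLIT at `w` — then `γ_H` has no norm partner in `G′_∞ = U(H′)(L⁺ ⊗ ℝ)`.
(Print: «if `γ` does not occur in `G′`», (14.2.1); Shelstad: Cartan subgroups of `G` not arising from `G′`.) [cite: Rogawski1990, §14.2 (14.2.1) p. 232; §4.3 p. 43] [cite: Shelstad1979, §4] -/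
theorem not_isArchNormPair_of_posDef_place (w : {w : InfinitePlace L // w.IsComplex})
    (hdef : (H'.map w.1.embedding).PosDef ∨ (-(H'.map w.1.embedding)).PosDef)
    (γH : ↥(UnitaryGroup.arch (↥(maximalRealSubfield L)) L (IsCMField.complexConj L) 2 (Matrix.of fun i j : Fin 2 => if i.val + j.val + 1 = 2 then (1 : L) else 0)) ×
      ↥(UnitaryGroup.arch (↥(maximalRealSubfield L)) L (IsCMField.complexConj L) 1 (Matrix.of fun i j : Fin 1 => if i.val + j.val + 1 = 1 then (1 : L) else 0)))
    {z : ℂ}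
    (hz : (((archPiEquivCM 2 L (Matrix.of fun i j : Fin 2 => if i.val + j.val + 1 = 2 then (1 : L) else 0) γH.1 w :
          ↥(archLocal L 2 (Matrix.of fun i j : Fin 2 => if i.val + j.val + 1 = 2 then (1 : L) else 0) w)) : GL (Fin 2) ℂ) : Matrix (Fin 2) (Fin 2) ℂ).charpoly.IsRoot z)
    (hz1 : ‖z‖ ≠ 1)
    (γ' : ↥(UnitaryGroup.arch (↥(maximalRealSubfield L)) L (IsCMField.complexConj L) 3 H')) :
    ¬ IsArchNormPair L H' γH γ' := by
  intro h
  have hmem : ((archPiEquivCM 3 L H' γ' w : ↥(archLocal L 3 H' w)) : GL (Fin 3) ℂ) ∈ unitaryGroupOfForm (starRingEnd ℂ) (H'.map w.1.embedding) :=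
    (mem_archLocal_iff L 3 H' w _).1 (archPiEquivCM 3 L H' γ' w).2
  have hroot : ((((archPiEquivCM 3 L H' γ' w : ↥(archLocal L 3 H' w)) : GL (Fin 3) ℂ)) : Matrix (Fin 3) (Fin 3) ℂ).charpoly.IsRoot z := by
    rw [charpoly_archPiEquivCM_of_isArchNormPair L H' γH γ' h w]
    exact Polynomial.root_mul.2 (Or.inl hz)
  rcases hdef with hpos | hneg
  · exact hz1 (norm_eq_one_of_isRoot_charpoly_of_mem_unitaryGroupOfForm_of_posDef hpos hmem hroot)
  · exact hz1 (norm_eq_one_of_isRoot_charpoly_of_mem_unitaryGroupOfForm_of_neg_posDef hneg hmem hroot)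

/-- **THE `Δ`-SIDE VANISHES IDENTICALLY AT A DEFINITE PLACE.**  Under the hypotheses of `not_isArchNormPair_of_posDef_place`, for EVERY archimedean transfer factor
`T` (★ `ArchTransferFactor L H′`, supported on norm pairs) and every `Φ : ConjClasses G′_∞ → ℂ`: `Σᶠ_{[γ′]} Δ(γ_H, γ′_{[γ′]}) · Φ([γ′]) = 0` — in particular the Δ″-side
`Σᶠ_{[γ′]} Δ″_∞(γ_H, γ′) Φ([γ′], a′)` of `stub_N9` on a Cartan of `H_∞` that is split at a definite place of `H′`. [cite: Rogawski1990, §4.3 (4.3.1) p. 43; §14.3 p. 234] -/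
theorem finsum_delta_mul_eq_zero_of_posDef_place (w : {w : InfinitePlace L // w.IsComplex})
    (hdef : (H'.map w.1.embedding).PosDef ∨ (-(H'.map w.1.embedding)).PosDef)
    (γH : ↥(UnitaryGroup.arch (↥(maximalRealSubfield L)) L (IsCMField.complexConj L) 2 (Matrix.of fun i j : Fin 2 => if i.val + j.val + 1 = 2 then (1 : L) else 0)) ×
      ↥(UnitaryGroup.arch (↥(maximalRealSubfield L)) L (IsCMField.complexConj L) 1 (Matrix.of fun i j : Fin 1 => if i.val + j.val + 1 = 1 then (1 : L) else 0)))
    {z : ℂ}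
    (hz : (((archPiEquivCM 2 L (Matrix.of fun i j : Fin 2 => if i.val + j.val + 1 = 2 then (1 : L) else 0) γH.1 w :
          ↥(archLocal L 2 (Matrix.of fun i j : Fin 2 => if i.val + j.val + 1 = 2 then (1 : L) else 0) w)) : GL (Fin 2) ℂ) : Matrix (Fin 2) (Fin 2) ℂ).charpoly.IsRoot z)
    (hz1 : ‖z‖ ≠ 1) (T : ArchTransferFactor L H')
    (Φ : ConjClasses ↥(UnitaryGroup.arch (↥(maximalRealSubfield L)) L (IsCMField.complexConj L) 3 H') → ℂ) :
    ∑ᶠ c : ConjClasses ↥(UnitaryGroup.arch (↥(maximalRealSubfield L)) L (IsCMField.complexConj L) 3 H'), T.Δ γH (Quotient.out c) * Φ c = 0 := by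
  have h0 : ∀ c : ConjClasses ↥(UnitaryGroup.arch (↥(maximalRealSubfield L)) L (IsCMField.complexConj L) 3 H'), T.Δ γH (Quotient.out c) * Φ c = 0 := fun c => by
    rw [T.eq_zero_of_not_rel γH (Quotient.out c) (not_isArchNormPair_of_posDef_place L H' w hdef γH hz hz1 _), zero_mul]
  simp only [h0, finsum_zero]

end NoPartner

end Literature.NumberTheory.Rogawski1990

end
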